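import Summits.AtomisticToContinuum.HydrodynamicLimit.Theses.RelayRaceLocality
import Summits.AtomisticToContinuum.HydrodynamicLimit.Theorems.RelayRaceLocalityLightConeInLawSketchLine
import Summits.AtomisticToContinuum.HydrodynamicLimit.Theorems.RelayRaceLocalityLightConeInLawStubTimeZero
import Summits.AtomisticToContinuum.HydrodynamicLimit.Theorems.RelayRaceLocalityLightConeInLawStubProfileIdOne
import Summits.AtomisticToContinuum.HydrodynamicLimit.Theorems.RelayRaceLocalityLightConeInLawStubProfileId
import Literature.MathematicalPhysics.KineticTheory.HardSphereEulerProofs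

/-!
# Line `Sketch` for the crux `LightConeInLaw` (stmt-AtomisticToContinuum-12500)

Route `RelayRaceLocality`, crux rank 2: the TWO-COPY LIGHT CONE IN LAW for the hard-sphere gas at
fixed reduced density (see the route file for the verbatim statement). The line is the ideator-1
`Sketch` (card `count-sufficiency-reduction`), reshaped by the line lead into a registered skeleton
(D-0027 §3.3 shape): the statics of the card (profile identification from the `t = 0` laws of large
numbers, the `t = 0` slice of the crux) are split off as provable stubs, and the positive-time
two-copy merging with IDENTIFIED velocity/temperature profiles is the single dynamical stub
(`stub_core`, held by the lead) — it contains the card's (S1) exterior screening and (S2)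
count-conditional insensitivity, which are not typable before the card's definition requests
D1/D2 exist.

## Status (rev 8, lead c2 = prover-line-stmt-AtomisticToContinuum-12500-c2-0, 2026-08-16; composition
unchanged from rev 7 of lead c1 — one open registered stub `stub_core`, held by the lead, wave: none)
Stubs 1–3 LANDED (p99261 `…TimeZero.stub_timeZero`, p99266 `…ProfileIdOne.stub_profileIdOne`,
p98633 `…ProfileId.stub_profileId`, all under `Theorems/RelayRaceLocalityLightConeInLawStub*.lean`);
the only `sorry` left is `stub_core` (held by the lead; wave: none — one registered stub). Rung 0 of
the core LANDED separately (p101746, `Theorems/RelayRaceLocalityLightConeInLawStubEquilibrium.lean`,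
registered stub `stub_equilibrium`): when BOTH gases are homogeneous the core's conclusion holds at
every `t`, by flow-invariance of the constant-profile canonical laws. Necessity bookkeeping LANDED
(p103773, `Theorems/RelayRaceLocalityLightConeInLawNecessary.lean`): `oneFamily_of_lightConeInLaw`
(crux ⇒ one-family light cone in law) and `particleNumberContinuity_of_lightConeInLaw` (crux ⇒ PNC).
Lead -0 ended cycle 1 with `promote-stub: stub_core`. Lead c1 (rev 6–7) keeps the composition
unchanged and has kernel-checked the MACROSCOPIC SANDWICH of the core (all `--supports`, namespace
`…Theorems.LightConeInLawSketch.{Sandwich,DoD}`):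
* `Sandwich.stub_core_of_hydroLimitGeneral_of_coneUniqueness` (p107464):
  (HL-gen) → (DoD) → `stub_core`, where (HL-gen) is the packing-guarded hydrodynamic limit for
  GENERAL comparison families `(ε N, n N)`, `n N · (ε N)³ → σ³` (the body of `HydroLimitInBand`,
  stmt-3093, for the crux's comparison gases) and (DoD) is reduced-cone uniqueness of classical
  hs-Euler solutions;
* (DoD) is now a THEOREM: `DoD.reducedConeUniqueness` (finite domain of dependence for classical
  hard-sphere Euler solutions in reduced units, UNCONDITIONAL — cone-weighted relative-energy
  method on `𝕋³` + the tree's analytic low-density equation of state `hsEosLowDensity_proof`;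
  files `…DoDFluxBound` p108302, `…DoDPseudoDist` p108335, `…DoDRescale`, `…Cone`);
* hence `DoD.stub_core_of_hydroLimitGeneral : (HL-gen) → stub_core`. Together with the landed
  necessity `crux ⇒ ParticleNumberContinuity` (p103773) the core sits between the summit's
  conjunct generalised to comparison families and PNC; the line's own MICROSCOPIC mechanism
  (screening + count-insensitivity, card count-sufficiency-reduction) remains untyped (needs
  definition requests D1/D2) and research-level.
Lead c2 (rev 8, this file): composition unchanged; LANDED the certificate
`CoreIff.core_of_lightConeInLaw : LightConeInLaw → stub_core` (`Theorems/RelayRaceLocalityLightConeInLawCoreIff.lean`,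
p119336) — with `DoD.lightConeInLaw_of_core` (p118058) the open stub is EQUIVALENT to the crux — and
typed the restatement menu R1–R3 (evidence `Restatements.lean`, rc 0). VERDICT: line `Sketch` DEAD at
`stub_core` (dossier `Lines/Sketch.dead.md`): the open stub is the item itself at `t > 0`; its only
typed sufficient condition (HL-gen) is of hydrodynamic-limit type and open; its necessary consequences
(PNC, one-family cone) are open; the card's microscopic mechanism does not survive typing.

## Composition (kernel-checked, sorry-free)

`LightConeInLaw_of : stub_core → LightConeInLaw` (rev 5; stubs 1–3 landed and used as theorems inside):
* `t = 0`: `stub_timeZero` (bounded-Lipschitz merging at time `0` from the two LLN hypotheses, the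
  agreement of the reduced data on `B(x₀, R)` and the support of `χ`);
* `0 < t`, `R - c t ≤ 0`: `χ ≡ 0`, both expectations equal `F 0` (inline);
* `0 < t`, `0 < R - c t`: `stub_core`, fed the identifications `U₁(0,·) = u₁`, `Θ₁(0,·) = θ₁`
  (`stub_profileIdOne`, the `(N+1)`-sphere local Gibbs family) and `U₂(0,·) = u₂`, `Θ₂(0,·) = θ₂`
  (`stub_profileId`, general canonical families with `n₂ N → ∞`, which follows from
  `n₂ N · hsDiameter σ₁ N ^ 3 → σ₂ ^ 3 > 0`, `tendsto_atTop_of_mul_hsDiameter`).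

## Disproof used

`Cruxes/LightConeInLaw/Disproof.lean` (cdisprove cycle 1, 1599 lines, read 2026-08-16T13:40Z by c1,
re-read 18:10Z by c2 — unchanged since 13:37Z): §0 no
kill; §1 the LLN hypotheses force `∫ρᵢ(0) = 1`, so `R ≥ 1 ⇒ σ₁ = σ₂` and the crux collapses to PNC
there; §2/§2b thermal agreement, velocity agreement, the support clause of `χ` and BOTH `t = 0` ties
are load-bearing (homogeneous two-state witness; landed `Theorems/LightConeInLaw/Negative/
HomogeneousWitness.lean`, p104314) — all five hypotheses are consumed by `LightConeInLaw_of`/`stub_core`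
as stated; §4 stubs 1–3 audited TRUE, `stub_core ⇔` crux at `t > 0` (no smuggled gap); §5 the sign of
the diameter is load-bearing (free streaming + stationary shear signals into the ball): any proof of
`stub_core` must use collisions — consistent with the stub's docstring ("false for the ideal gas").
No `-- Targets` section exists; no `stub_*_false` theorem; nothing importable beyond rung 0's own
invariance lemma.
-/

namespace Summit.AtomisticToContinuum.HydrodynamicLimit.Cruxes.LightConeInLaw.Sketch

open scoped BigOperators Topology Classical ENNReal
open Filter Set MeasureTheory
open Literature.MathematicalPhysics.KineticTheory Literature.Analysis.FluidPDE
  Literature.Analysis.FunctionSpaces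
open Summit.AtomisticToContinuum.HydrodynamicLimit.Theorems.LightConeInLawSketch

noncomputable section

/-! ## Vocabulary (landed)

`G3`, `LLNAt`, `tendstoHydroFieldsAt_iff_LLNAt`, `tendsto_atTop_of_mul_hsDiameter` live in the line
vocabulary file `Theorems/RelayRaceLocalityLightConeInLawSketchLine.lean` (p96526, namespace
`…Theorems.LightConeInLawSketch`, opened above); the registered signatures below read verbatim. -/

/-! ## Registered stubs (`Holds.stub_*`, bodies `sorry`) -/

namespace Holds

/-- STUB 1 (TIME ZERO; LANDED p99261 as `TimeZero.stub_timeZero`). The `t = 0` slice of the crux, for two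
arbitrary families of probability laws: if the three empirical fields of each gas at time `0`
converge in probability to `(ρᵢ, ρᵢUᵢ, Eᵢ)` tested against every continuous `χ`, the reduced data
`(ρσ³, U, Θ)` agree on `B(x₀, R)` and `χ` vanishes outside `B(x₀, R)`, then for every bounded
`1`-Lipschitz `F` the expectations of `F` of the reduced fields tested against `χ` merge.
Proof: the reduced limits coincide (`χ ρ₁ σ₁³ = χ ρ₂ σ₂³`, … pointwise), so both expectations tend
to `F` of the common limit: `|E F(X_N) − F(L)| ≤ δ + 2 P(dist(X_N, L) > δ)` with the sup metric on
`ℝ × V3 × ℝ`, a union bound over the three fields at level `δ/σᵢ³`, and measurability of the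
empirical fields composed with the measurable map `flow 0` (finite sums, `empirical*Field_eq_sum`). -/
theorem stub_timeZero :
    ∀ (n₁ n₂ : ℕ → ℕ) (ε₁ ε₂ : ℕ → ℝ) (σ₁ σ₂ : ℝ), 0 < σ₁ → 0 < σ₂ →
    ∀ (Φ₁ : (N : ℕ) → HardSphereFlow G3 (ε₁ N) (n₁ N))
      (Φ₂ : (N : ℕ) → HardSphereFlow G3 (ε₂ N) (n₂ N))
      (P₁ : (N : ℕ) → Measure (Config (n₁ N) (Fin 3) T3))
      (P₂ : (N : ℕ) → Measure (Config (n₂ N) (Fin 3) T3)),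
      (∀ N, IsProbabilityMeasure (P₁ N)) → (∀ N, IsProbabilityMeasure (P₂ N)) →
    ∀ (ρ₁ Θ₁ ρ₂ Θ₂ : T3 → ℝ) (U₁ U₂ : T3 → V3),
      LLNAt n₁ P₁ Φ₁ ρ₁ U₁ Θ₁ 0 → LLNAt n₂ P₂ Φ₂ ρ₂ U₂ Θ₂ 0 →
    ∀ (x₀ : T3) (R : ℝ),
      (∀ x, Torus.euclidDist x x₀ < R →
        ρ₁ x * σ₁ ^ 3 = ρ₂ x * σ₂ ^ 3 ∧ U₁ x = U₂ x ∧ Θ₁ x = Θ₂ x) →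
    ∀ χ : T3 → ℝ, Continuous χ → (∀ x, R ≤ Torus.euclidDist x x₀ → χ x = 0) →
    ∀ F : ℝ × V3 × ℝ → ℝ, LipschitzWith 1 F → (∀ p, |F p| ≤ 1) →
      Tendsto (fun N =>
        (∫ z, F (σ₁ ^ 3 * empiricalDensityField ((Φ₁ N).flow 0 z) χ,
            (σ₁ ^ 3) • empiricalMomentumField ((Φ₁ N).flow 0 z) χ,
            σ₁ ^ 3 * empiricalEnergyField ((Φ₁ N).flow 0 z) χ) ∂(P₁ N)) -
        ∫ z, F (σ₂ ^ 3 * empiricalDensityField ((Φ₂ N).flow 0 z) χ,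
            (σ₂ ^ 3) • empiricalMomentumField ((Φ₂ N).flow 0 z) χ,
            σ₂ ^ 3 * empiricalEnergyField ((Φ₂ N).flow 0 z) χ) ∂(P₂ N)) atTop (𝓝 0) :=
  TimeZero.stub_timeZero

/-- STUB 2 (PROFILE IDENTIFICATION, `(N+1)`-sphere family; LANDED p99266 as `ProfileIdOne.stub_profileIdOne`). If under
the local Gibbs laws `localGibbsLaw σ a u θ N` (probability measures) the empirical fields at time
`0` converge in probability to `(ρ₀, ρ₀U₀, ρ₀(|U₀|²/2 + 3Θ₀/2))` with `ρ₀, U₀, Θ₀` continuous and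
`ρ₀ > 0`, then `U₀ = u` and `Θ₀ = θ`. Proof: conditionally on the positions the velocities are
independent Gaussians `N(u(xᵢ), θ(xᵢ))` (`lintegral_localGibbsMeasure`), so
`(N+1)⁻¹∑χ(xᵢ)(vᵢ − u(xᵢ)) → 0` and `(N+1)⁻¹∑χ(xᵢ)(|vᵢ|²/2 − |u(xᵢ)|²/2 − 3θ(xᵢ)/2) → 0` in
probability (`localGibbsMeasure_velFluct_le`, `localGibbsLaw_preimage_flow_zero`); comparing with
the density LLN tested against `χ uᵏ`, `χ(|u|²/2 + 3θ/2)` (uniqueness of limits in probability under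
probability measures) gives `∫ χ (ρ₀ U₀ᵏ − ρ₀ uᵏ) = 0` for all continuous `χ`, hence (continuity,
`χ :=` the integrand, Haar measure has full support) `ρ₀ U₀ = ρ₀ u`, then `ρ₀ > 0`; same for `θ`. -/
theorem stub_profileIdOne :
    ∀ (a θ : T3 → ℝ) (u : T3 → V3), Continuous a → Continuous θ → Continuous u →
      (∀ x, 0 < a x) → (∀ x, 0 < θ x) →
    ∀ σ : ℝ, 0 < σ → ∀ Φ : (N : ℕ) → HardSphereFlow G3 (hsDiameter σ N) (N + 1),
      (∀ N, IsProbabilityMeasure (localGibbsLaw σ a u θ N (Φ N))) →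
    ∀ (ρ₀ Θ₀ : T3 → ℝ) (U₀ : T3 → V3), Continuous ρ₀ → Continuous U₀ → Continuous Θ₀ →
      (∀ x, 0 < ρ₀ x) →
      TendstoHydroFieldsAt (fun N => localGibbsLaw σ a u θ N (Φ N)) Φ
        (fun _ => ρ₀) (fun _ => U₀) (fun _ => Θ₀) 0 →
      ∀ x, U₀ x = u x ∧ Θ₀ x = θ x :=
  ProfileIdOne.stub_profileIdOne

/-- STUB 3 (PROFILE IDENTIFICATION, general canonical families; LANDED p98633 as `ProfileId.stub_profileId`).
The same identification for the canonical laws `particleLaw Φ (canonicalDensity G3 (ε N) (n N)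
(localGibbsProfile a u θ))` of `n N → ∞` spheres of arbitrary diameters `ε N` (gas 2 of the crux:
`n = n₂`, `ε N = hsDiameter σ₁ N`). Proof: as STUB 2, with the position/velocity disintegration
`lintegral_gibbsWeight_mul` (stated for general `ε, n`) in place of `lintegral_localGibbsMeasure`,
`particleLaw_eq_withDensity` + `canonicalDensity_eq_zero_of_notMem` to pass from the Liouville
density to the Lebesgue density, `Φ.flow_zero` a.e. (`particleLaw ≪ liouville`), and the Chebyshev
rate `C²B/(n N · δ²) → 0` from `n N → ∞`. -/
theorem stub_profileId :
    ∀ (a θ : T3 → ℝ) (u : T3 → V3), Continuous a → Continuous θ → Continuous u →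
      (∀ x, 0 < a x) → (∀ x, 0 < θ x) →
    ∀ (n : ℕ → ℕ) (ε : ℕ → ℝ), Tendsto n atTop atTop →
    ∀ Φ : (N : ℕ) → HardSphereFlow G3 (ε N) (n N),
      (∀ N, IsProbabilityMeasure
        (particleLaw (Φ N) (canonicalDensity G3 (ε N) (n N) (localGibbsProfile a u θ)))) →
    ∀ (ρ₀ Θ₀ : T3 → ℝ) (U₀ : T3 → V3), Continuous ρ₀ → Continuous U₀ → Continuous Θ₀ →
      (∀ x, 0 < ρ₀ x) →
      LLNAt n (fun N => particleLaw (Φ N)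
        (canonicalDensity G3 (ε N) (n N) (localGibbsProfile a u θ))) Φ ρ₀ U₀ Θ₀ 0 →
      ∀ x, U₀ x = u x ∧ Θ₀ x = θ x :=
  ProfileId.stub_profileId

/-- STUB 4 (CORE: positive-time two-copy merging with identified profiles; size XL — the crux
proper, held by the lead). Verbatim the crux (its `let P₁; let P₂` written out), except: `0 < t` (the slice `t = 0` is STUB 1),
`0 < R − c t` (otherwise `χ ≡ 0` and there is nothing to prove), and two extra hypotheses — the
velocity and temperature Euler data at time `0` of each gas ARE its local Gibbs profiles
(`U₁(0,·) = u₁`, `Θ₁(0,·) = θ₁`, `U₂(0,·) = u₂`, `Θ₂(0,·) = θ₂`; STUBS 2–3), so that with the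
agreement clause `u₁ = u₂`, `θ₁ = θ₂` on `B(x₀, R)`: inside the ball the two canonical laws have the
same velocity/temperature profiles and activities with equal LLN density limits in reduced units.
Content (card count-sufficiency-reduction): condition each gas on (exterior configuration, ball
count); the interior canonical kernels then coincide (DLR sufficiency; needs activity identification
`a₁ ∝ a₂` on the ball via EOS injectivity), and the claim splits into (S1) exterior screening along
alternating two-run collision chains across the buffer `B(x₀,R) ∖ B(x₀,R − ct)` (Lieb–Robinson type,
needs the route's M2 along the true law) and (S2) count-conditional insensitivity over `o(N)` count
windows (one gas, first moment; NECESSARY: crux ⇒ ParticleNumberContinuity, ideator Sketch).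
Why it might fail: (S1) needs mesoscale regularity of the non-equilibrium law (unproved); (S2) is an
unproved law-level continuity of the macroscopic dynamics in the total mass of a ball. False for the
ideal gas (free streaming crosses any buffer), as it must be. -/
theorem stub_core :
    ∃ η₀ : ℝ, 0 < η₀ ∧ ∀ M : ℝ, 0 < M → ∃ c : ℝ, 0 < c ∧
    ∀ (a₁ θ₁ a₂ θ₂ : T3 → ℝ) (u₁ u₂ : T3 → V3), Continuous a₁ → Continuous θ₁ → Continuous u₁ →
      Continuous a₂ → Continuous θ₂ → Continuous u₂ → (∀ x, 0 < a₁ x) → (∀ x, 0 < θ₁ x) →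
      (∀ x, 0 < a₂ x) → (∀ x, 0 < θ₂ x) →
    ∃ σ₀ : ℝ, 0 < σ₀ ∧ ∀ (σ₁ σ₂ : ℝ), 0 < σ₁ → σ₁ < σ₀ → 0 < σ₂ → σ₂ < σ₀ →
    ∀ n₂ : ℕ → ℕ, Tendsto (fun N => (n₂ N : ℝ) * hsDiameter σ₁ N ^ 3) atTop (𝓝 (σ₂ ^ 3)) →
    ∀ (T₁ T₂ : ℝ) (ρ₁ Θ₁ ρ₂ Θ₂ : ℝ → T3 → ℝ) (U₁ U₂ : ℝ → T3 → V3),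
      IsHardSphereEulerSolution σ₁ T₁ ρ₁ U₁ Θ₁ → IsHardSphereEulerSolution σ₂ T₂ ρ₂ U₂ Θ₂ →
    ∀ (Φ₁ : (N : ℕ) → HardSphereFlow G3 (hsDiameter σ₁ N) (N + 1))
      (Φ₂ : (N : ℕ) → HardSphereFlow G3 (hsDiameter σ₁ N) (n₂ N)),
    (∀ N, IsProbabilityMeasure (localGibbsLaw σ₁ a₁ u₁ θ₁ N (Φ₁ N))) →
    (∀ N, IsProbabilityMeasure (particleLaw (Φ₂ N)
      (canonicalDensity G3 (hsDiameter σ₁ N) (n₂ N) (localGibbsProfile a₂ u₂ θ₂)))) →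
    TendstoHydroFieldsAt (fun N => localGibbsLaw σ₁ a₁ u₁ θ₁ N (Φ₁ N)) Φ₁ ρ₁ U₁ Θ₁ 0 →
    LLNAt n₂ (fun N => particleLaw (Φ₂ N)
      (canonicalDensity G3 (hsDiameter σ₁ N) (n₂ N) (localGibbsProfile a₂ u₂ θ₂))) Φ₂
      (ρ₂ 0) (U₂ 0) (Θ₂ 0) 0 →
    (∀ x, U₁ 0 x = u₁ x ∧ Θ₁ 0 x = θ₁ x) → (∀ x, U₂ 0 x = u₂ x ∧ Θ₂ 0 x = θ₂ x) →
    ∀ t : ℝ, 0 < t → t < T₁ → t < T₂ →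
      (∀ s ∈ Set.Icc 0 t, ∀ x, ρ₁ s x * σ₁ ^ 3 < η₀ ∧ Θ₁ s x ≤ M ∧ ‖U₁ s x‖ ≤ M ∧
        ρ₂ s x * σ₂ ^ 3 < η₀ ∧ Θ₂ s x ≤ M ∧ ‖U₂ s x‖ ≤ M) →
    ∀ (x₀ : T3) (R : ℝ), 0 < R - c * t →
      (∀ x, Torus.euclidDist x x₀ < R →
        ρ₁ 0 x * σ₁ ^ 3 = ρ₂ 0 x * σ₂ ^ 3 ∧ U₁ 0 x = U₂ 0 x ∧ Θ₁ 0 x = Θ₂ 0 x) →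
    ∀ χ : T3 → ℝ, Continuous χ → (∀ x, R - c * t ≤ Torus.euclidDist x x₀ → χ x = 0) →
    ∀ F : ℝ × V3 × ℝ → ℝ, LipschitzWith 1 F → (∀ p, |F p| ≤ 1) →
      Tendsto (fun N =>
        (∫ z, F (σ₁ ^ 3 * empiricalDensityField ((Φ₁ N).flow t z) χ,
            (σ₁ ^ 3) • empiricalMomentumField ((Φ₁ N).flow t z) χ,
            σ₁ ^ 3 * empiricalEnergyField ((Φ₁ N).flow t z) χ) ∂(localGibbsLaw σ₁ a₁ u₁ θ₁ N (Φ₁ N))) -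
        ∫ z, F (σ₂ ^ 3 * empiricalDensityField ((Φ₂ N).flow t z) χ,
            (σ₂ ^ 3) • empiricalMomentumField ((Φ₂ N).flow t z) χ,
            σ₂ ^ 3 * empiricalEnergyField ((Φ₂ N).flow t z) χ) ∂(particleLaw (Φ₂ N)
              (canonicalDensity G3 (hsDiameter σ₁ N) (n₂ N) (localGibbsProfile a₂ u₂ θ₂)))) atTop (𝓝 0) := by
  sorry

end Holds

/-! ## Stub statements by name (D-0027 §3.3) -/

/-- Statement of the one OPEN registered stub (`Holds.stub_core`), by name. (Stubs 1–3 are landed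
theorems now — `Holds.stub_timeZero`, `Holds.stub_profileIdOne`, `Holds.stub_profileId` are used
directly inside `LightConeInLaw_of`.) -/
def stub_core : Prop := type_of% Holds.stub_core

/-! ## Composition (sorry-free): the open stub `stub_core` (+ landed stubs 1–3) ⟹ the crux BY NAME -/

/-- **The skeleton theorem.** `η₀, c, σ₀` are those of `stub_core`. Given all data of the crux:
if `t = 0`, `stub_timeZero`; if `0 < t` and `R − c t ≤ 0`, `χ ≡ 0` and both expectations are
`F 0`; otherwise `stub_core`, whose two identification hypotheses are supplied by
`stub_profileIdOne` (gas 1; the Euler data at time `0` are continuous and `ρ₁(0,·) > 0` because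
`0 ∈ [0, T₁)`) and `stub_profileId` (gas 2; `n₂ N → ∞` by `tendsto_atTop_of_mul_hsDiameter`). -/
theorem LightConeInLaw_of (hc : stub_core) :
    Summit.AtomisticToContinuum.HydrodynamicLimit.Theses.RelayRaceLocality.LightConeInLaw := by
  have H0 := Holds.stub_timeZero
  have H1 := Holds.stub_profileIdOne
  have H2 := Holds.stub_profileId
  obtain ⟨η₀, hη₀, Hc⟩ := (hc : type_of% Holds.stub_core)
  refine ⟨η₀, hη₀, fun M hM => ?_⟩
  obtain ⟨c, hc0, Hc'⟩ := Hc M hM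
  refine ⟨c, hc0, ?_⟩
  intro a₁ θ₁ a₂ θ₂ u₁ u₂ ha₁ hθ₁ hu₁ ha₂ hθ₂ hu₂ ha₁0 hθ₁0 ha₂0 hθ₂0
  obtain ⟨σ₀, hσ₀, H⟩ := Hc' a₁ θ₁ a₂ θ₂ u₁ u₂ ha₁ hθ₁ hu₁ ha₂ hθ₂ hu₂ ha₁0 hθ₁0 ha₂0 hθ₂0
  refine ⟨σ₀, hσ₀, ?_⟩
  intro σ₁ σ₂ hσ₁ hσ₁' hσ₂ hσ₂' n₂ hn₂ T₁ T₂ ρ₁ Θ₁ ρ₂ Θ₂ U₁ U₂ hsol₁ hsol₂ Φ₁ Φ₂ P₁ P₂ hP₁ hP₂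
    hL₁ hL₂ t ht htT₁ htT₂ hguard x₀ R hagree χ hχ hsupp F hF hFb
  rcases ht.eq_or_lt with rfl | htpos
  · -- the slice `t = 0`
    have hsupp' : ∀ x, R ≤ Torus.euclidDist x x₀ → χ x = 0 := fun x hx =>
      hsupp x (by simpa using hx)
    exact H0 (fun N => N + 1) n₂ (fun N => hsDiameter σ₁ N) (fun N => hsDiameter σ₁ N) σ₁ σ₂
      hσ₁ hσ₂ Φ₁ Φ₂ P₁ P₂ hP₁ hP₂ (ρ₁ 0) (Θ₁ 0) (ρ₂ 0) (Θ₂ 0) (U₁ 0) (U₂ 0) hL₁ hL₂ x₀ R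
      hagree χ hχ hsupp' F hF hFb
  by_cases hR : 0 < R - c * t
  · -- positive time, non-trivial support: the core, fed the profile identifications
    have h0T₁ : (0 : ℝ) ∈ Set.Ico 0 T₁ := ⟨le_rfl, ht.trans_lt htT₁⟩
    have h0T₂ : (0 : ℝ) ∈ Set.Ico 0 T₂ := ⟨le_rfl, ht.trans_lt htT₂⟩
    have hid₁ : ∀ x, U₁ 0 x = u₁ x ∧ Θ₁ 0 x = θ₁ x :=
      H1 a₁ θ₁ u₁ ha₁ hθ₁ hu₁ ha₁0 hθ₁0 σ₁ hσ₁ Φ₁ hP₁ (ρ₁ 0) (Θ₁ 0) (U₁ 0)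
        (hsol₁.smooth_density.isSmooth_slice h0T₁).continuous
        (hsol₁.smooth_velocity.isSmooth_slice h0T₁).continuous
        (hsol₁.smooth_temperature.isSmooth_slice h0T₁).continuous
        (hsol₁.density_pos 0 h0T₁) hL₁
    have hid₂ : ∀ x, U₂ 0 x = u₂ x ∧ Θ₂ 0 x = θ₂ x :=
      H2 a₂ θ₂ u₂ ha₂ hθ₂ hu₂ ha₂0 hθ₂0 n₂ (fun N => hsDiameter σ₁ N)
        (tendsto_atTop_of_mul_hsDiameter σ₁ σ₂ hσ₁ hσ₂ n₂ hn₂) Φ₂ hP₂ (ρ₂ 0) (Θ₂ 0) (U₂ 0)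
        (hsol₂.smooth_density.isSmooth_slice h0T₂).continuous
        (hsol₂.smooth_velocity.isSmooth_slice h0T₂).continuous
        (hsol₂.smooth_temperature.isSmooth_slice h0T₂).continuous
        (hsol₂.density_pos 0 h0T₂) hL₂
    exact H σ₁ σ₂ hσ₁ hσ₁' hσ₂ hσ₂' n₂ hn₂ T₁ T₂ ρ₁ Θ₁ ρ₂ Θ₂ U₁ U₂ hsol₁ hsol₂ Φ₁ Φ₂ hP₁ hP₂
      hL₁ hL₂ hid₁ hid₂ t htpos htT₁ htT₂ hguard x₀ R hR hagree χ hχ hsupp F hF hFb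
  · -- positive time, `R - c t ≤ 0`: the test function vanishes identically
    have hzero : ∀ x, χ x = 0 := fun x =>
      hsupp x ((not_lt.mp hR).trans (norm_nonneg _))
    have hχ0 : χ = fun _ => 0 := funext hzero
    subst hχ0
    have hconst : (fun N =>
        (∫ z, F (σ₁ ^ 3 * empiricalDensityField ((Φ₁ N).flow t z) (fun _ => 0),
            (σ₁ ^ 3) • empiricalMomentumField ((Φ₁ N).flow t z) (fun _ => 0),
            σ₁ ^ 3 * empiricalEnergyField ((Φ₁ N).flow t z) (fun _ => 0)) ∂(P₁ N)) -
        ∫ z, F (σ₂ ^ 3 * empiricalDensityField ((Φ₂ N).flow t z) (fun _ => 0),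
            (σ₂ ^ 3) • empiricalMomentumField ((Φ₂ N).flow t z) (fun _ => 0),
            σ₂ ^ 3 * empiricalEnergyField ((Φ₂ N).flow t z) (fun _ => 0)) ∂(P₂ N)) =
        fun _ => 0 := by
      funext N
      haveI := hP₁ N
      haveI := hP₂ N
      simp [empiricalDensityField, empiricalMomentumField, empiricalEnergyField]
    rw [hconst]
    exact tendsto_const_nhds

/-- D-0027 §3.3 shape: the crux from the registered stubs — an `example`, so that
`LightConeInLaw_of` stays the unique theorem concluding the crux; it becomes the proof of the item
once the last `sorry` (`stub_core`) is discharged. -/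
example : Summit.AtomisticToContinuum.HydrodynamicLimit.Theses.RelayRaceLocality.LightConeInLaw :=
  LightConeInLaw_of Holds.stub_core

end

end Summit.AtomisticToContinuum.HydrodynamicLimit.Cruxes.LightConeInLaw.Sketch
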